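import Mathlib
import HarnessLib
import HarnessLib.Audit
import Summits.FinalStateConjecture.Statement
import Literature.Geometry.Lorentzian.TrappedSurface
import Literature.Geometry.Lorentzian.EventHorizon
import HarnessLib.Audit.Status.Attr

/-!
Route: RootDecompTrappedBasinCells

# Route RootDecompTrappedBasinCells — Root decomposition N2b «TrappedBasinCells» — N2 with the
trapped basin cut by censorship and C⁰-settling (dispersive ∧ trapped-naked ∧ trapped-capture ∧
trapped-extremal ∧ two threshold exits)

DECOMPOSITION CELL decomp-fsc (D-0178; doctrine D-0170/0171/0172), summit S =
`_root_.FinalStateConjecture` exactly as typed; LADDER rung 0 — NOTHING IN THIS FILE PROVES THE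
FINAL STATE CONJECTURE. OR-SIBLING REFINEMENT of Theses/RootDecompCausalCells.lean
(route-FinalStateConjecture-RootDecompCausalCells, node N2 «BasinsAndThreshold»): this file = node
N2b «TrappedBasinCells» (lens decomp-fsc-lens-2 gen 2), CLEARED by the critic decomp-fsc-crit-1-g0
2026-08-30T02:40:09Z with the FILING RULING (α): «a SEPARATE THIN ROUTE whose closes takes the three
untouched N2 cells BY SIGNATURE (stmt-FinalStateConjecture-24766 DispersiveExit, 24765
ExtremalThresholdExit, 24767 NakedThresholdExit — dedup-attached, not re-filed) and the three NEW
trapped cells; do not resplit TrappedExit (stmt-24764) on the parent route, whose filed gen-1 cut by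
the capture axis (TrappedWild stmt-25402 + PerturbativeCell stmt-24307) stands» (D-0019: an
alternative decomposition of the same statement is a separate route sharing the decls). The whole
AND/OR tree is kept in HOME/TREE.md (HOME = run/shared/lean/pub/decomp-fsc).
ROOT AND-node (exact; lens kernel `root_iff`/`trappedExit_iff_children` against the born decl in
HOME/decomp-fsc-lens-2/g2/TrappedBasinCells.lean @581961c2; writer kernel `closes` +
`trappedExit_of_cells` in folder/n2b/Sketch.lean, rc 0 / 0 sorry): S ⟺ DispersiveExit ∧
(TrappedNakedExit ∧ TrappedCaptureExit ∧ TrappedExtremalExit) ∧ ExtremalThresholdExit ∧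
NakedThresholdExit, where the trapped basin 𝓣 ∖ 𝓒 (every MGHD contains a closed trapped sphere to
the future of the data, no MGHD-complete alternative) is cut by two FATE predicates of the datum's
own MGHDs: Cens (complete future null infinity in every MGHD) and P_w⁰ (= the born weak property P_w
with chart regularity 2 ↦ 0: censored + an honest C⁰ Kerr final-state decomposition with |aᵢ| ≤ Mᵢ
and the Statement's four clauses) — 𝓣₁ TrappedNakedExit (¬Cens: WCC after trapping), 𝓣₂
TrappedCaptureExit (Cens ∧ ¬P_w⁰: large-data capture + rigidity + no eternal radiation AT C⁰ — the
NEW RESIDUAL, implied outright by the registered ∀-data item stmt-FinalStateConjecture-17296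
`GlobalAttraction.CensoredExteriorsSettle`, lens kernel
`trappedCaptureExit_of_censoredExteriorsSettle`), 𝓣₃ TrappedExtremalExit (P_w⁰: generic THIRD LAW
after trapping + the pointwise C⁰→C² upgrade, content pinned by stmt-17298 `SubextremalUpgrade`,
lens kernel `exists_extremal_hole_of_exceptional`); cells exhaustive and pairwise disjoint (P_w⁰ ⟹
Cens, kernel `censored_of_weakProperty0`). Cure target = P_Σ verbatim in every piece, tame
genericity verbatim. Tags (critic 02:40:09Z): TrappedCaptureExit [WEAKER·RESIDUAL-relieved (of WCC →
𝓣₁, third law → 𝓣₃, C⁰→C² upgrade → 17298) · GENERIC-TYPE (conjecturally EMPTY cell) · IDEA-NEEDED ·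
INSTRUMENTABLE; 17296's crux line Cruxes/CensoredExteriorsSettle is cited, not re-cut];
TrappedNakedExit [WEAKER·COUNTS·SPECIAL-TYPE (WCC in the presence of a trapped sphere; empty in the
spherical scalar-field model, expected inhabited of codim ≥ 1 in vacuum) · IDEA-NEEDED ·
BARRIER-adjacent nakedSingularityInstability honoured as the cure]; TrappedExtremalExit
[WEAKER·COUNTS·SPECIAL-TYPE (transversal crossing of |a_f|/M_f = 1 along a tame line) ·
MODEL-ANALOGUE in print not a rung (Kehle–Unger arXiv:2211.15742 Thm 1, arXiv:2402.10190 p.20) ·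
INSTRUMENTABLE (remnant-spin census) · BARRIER AretakisInstability placed OUTSIDE (the piece asks to
LEAVE the cell)]; the three sibling cells carry their N2 birth tags (DispersiveExit thin,
ExtremalThresholdExit thin, NakedThresholdExit COUNTS). No EQUIV layer; no ∀-data binder in `closes`
(17296 / 17298 are DOORS by name, outside closes); no theorem-emptied cell. Relation to the parent's
filed split (kernel, lens `closes_T` + anti; writer `trappedExit_of_cells`): TrappedNakedExit ∧
TrappedCaptureExit ∧ TrappedExtremalExit ⟹ TrappedExit (24764) ⟹ TrappedWild (25402) — 25402 is
dominated by the CONJUNCTION of this route's trapped leaves, by no single one. Writer typing: every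
item is ONE line over EXISTING declarations (lets P / Disp / Trap byte-identical to stmt-24764, Pw0
= the born let Pw with `O 2` ↦ `O 0`, Cens new; verified bytewise in folder/n2b). Census:
HOME/census/COSTUME-CENSUS-v2.md (cutoff STATUS line 65).
Lean: `DispersiveExit ∧ TrappedNakedExit ∧ TrappedCaptureExit ∧ TrappedExtremalExit ∧
ExtremalThresholdExit ∧ NakedThresholdExit` (the six decls of this file; exactness `root_iff`
kernel-checked by the lens against the born N2 decls, `closes` in folder/n2b/glue.lean)

## Assembly
Pure logic inside `closes` (folder/n2b/glue.lean, 0 sorry): for an admissible exceptional datum d,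
nested case splits — dispersive (DispersiveExit) / else trapped: split on P_w⁰ (TrappedExtremalExit)
else on Cens (TrappedCaptureExit / TrappedNakedExit) / else threshold, split on P_w
(ExtremalThresholdExit / NakedThresholdExit) — and the cure «∀ c ≠ 0, P_Σ (F c)» is read off the
exit family. The relation to the parent's node is the writer theorem `trappedExit_of_cells` (the
three trapped cells ⟹ stmt-24764's statement by value).

Rationale: WHY THIS LINE. Population splits of the exceptional set with cure target P are free and exact
(critic `fsc_iff_cellSplit`; tame genericity is monotone but not ∧-closed, tree
`isTameChristodoulouGeneric_and_fails`, so no clause is split off), hence judged on content: the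
cells here are three DIFFERENT open programmes with disjoint toolkits — (𝓒) rigidity / no-breather
theorems for complete vacuum spacetimes (Lichnerowicz, Anderson doi:10.1007/PL00001021,
Alexakis–Schlue arXiv:1504.04592; Luk–Oh arXiv:2108.13379 Thm 1.3 gives openness of dispersion only
among decaying solutions), (𝓣) capture + black-hole stability + rigidity of the stationary end state
(KlainermanSzeftel2020, Klainerman2025, Hintz2026 = arXiv:2606.28253 CLAIM for |a| < M), (𝓝) weak
cosmic censorship and the third law / extremal critical collapse (Christodoulou1999;
arXiv:1912.08478; arXiv:2211.15742, arXiv:2402.10190) — so difficulty is DISTRIBUTED and the two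
registered hard cores are separated by the cut (capture/rigidity in 𝓣, censorship of untrapped naked
data in 𝓝 ∧ ¬P_w). Penrose's incompleteness theorem (doi:10.1103/PhysRevLett.14.57) is the structure
lemma making 𝓒 and 𝓣 disjoint but is not needed for exactness (excluded middle). Imported from
outside GR: nothing; the threshold picture is calibrated on the charged model (Kehle–Unger: critical
set = codimension-one hypersurface B_crit met transversally). What it does that prior routes do not
(census RT2): the sector routes split all data by completeness and carry pointwise «complete ⇒
disperse» pieces not implied by S; this node restricts every piece to exceptional data (all four
S-implied in the kernel) and adds the extremality layer on the threshold. GEN-2 DELTA (this file):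
the trapped basin is CELL-IFIED along route GlobalAttraction's architecture (∀-data C⁰ settling ∧
generic censorship / third law ∧ upgrade) into S-IMPLIED pieces — strictly more honest than the
∀-data original and citing it by name (stmt-17296, stmt-17298); C⁰ rather than the born C² P_w
because a censored exterior settling to an exactly extremal hole is expected to settle in C⁰/C¹ but
NOT in C² at the horizon (Aretakis: conserved horizon charges), so typed at C⁰ such data sit in the
extremal cell 𝓣₃ where their exit mechanism (third law) lives, and the capture residual 𝓣₂ becomes
the cell the registered C⁰ door closes by name.

RANKED CRUXES. #2 TrappedCaptureExit (crux) — PIECE 𝓣₂ — TrappedCaptureExit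
[WEAKER·RESIDUAL-relieved·GENERIC-TYPE — critic CLEARED 2026-08-30T02:40:09Z; NEW RESIDUAL of the
trapped basin (capture + rigidity + no eternal radiation at C⁰ for censored collapsed data); implied
outright by the registered ∀-data item stmt-FinalStateConjecture-17296
GlobalAttraction.CensoredExteriorsSettle (cited by name, its crux line
Cruxes/CensoredExteriorsSettle not re-cut); hard cores stmt-17308 / stmt-10745 live here; leaf
IDEA-NEEDED + INSTRUMENTABLE]. For every Σ and every admissible P_Σ-exceptional datum d, not of
dispersive type, all of whose MGHDs contain a closed trapped sphere to the future of the data, ALL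
of whose MGHDs have complete future null infinity, and which fails the weak C⁰ property P_w⁰ (some
MGHD admits no honest C⁰ Kerr final-state decomposition with |a_i| ≤ M_i, O = exteriorOf,
RaysStayInClosure, HasExhaustiveCharts, IsFutureOriented), there are one end e and a tame (order 1
at e), immersed-at-0, injective one-parameter family F of admissible data with F 0 = d all of whose
members c ≠ 0 satisfy P_Σ. Content: large-data capture + rigidity without analyticity + no eternally
radiating censored exteriors, at C⁰; implied outright by GlobalAttraction.CensoredExteriorsSettle
(stmt-17296). [difficulty: open-problem] (why it might fail: a tame-open set of trapped admissible
data with censored, never C⁰-settling exteriors — smooth non-Kerr stationary vacuum hair, an eternal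
floating bound companion outside the horizon, or a Burnett-type high-frequency tail not even
C⁰-settled.) [arXiv:2606.28253, KlainermanSzeftel2023, GiorgiKlainermanSzeftel2022, arXiv:0904.0982,
arXiv:1710.01722, arXiv:2009.08968, doi:10.1103/PhysRevLett.14.57]
#3 TrappedNakedExit (crux) — PIECE 𝓣₁ — TrappedNakedExit [WEAKER·COUNTS·SPECIAL-TYPE — critic
CLEARED 2026-08-30T02:40:09Z; weak cosmic censorship AFTER trapping (cell empty in the spherical
scalar-field model doi:10.1088/0264-9381/22/11/019, expected codim ≥ 1 in vacuum); subsumes lens-5's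
TrappedNakedCell (critic ruling); leaf IDEA-NEEDED; BARRIER-adjacent nakedSingularityInstability
honoured as the cure]. For every Σ and every admissible P_Σ-exceptional datum d, not of dispersive
type, all of whose MGHDs contain a closed trapped sphere to the future of the data, and SOME of
whose MGHDs has incomplete future null infinity (weak cosmic censorship fails in the presence of a
trapped sphere), there are one end e and a tame immersed injective one-parameter family F of
admissible data with F 0 = d whose members c ≠ 0 satisfy P_Σ. Model: the cell is EMPTY for
spherically symmetric Einstein–Maxwell–scalar field / Einstein–Vlasov (Dafermos 2005; Rendall 2008
§11.5); in vacuum 3+1 expected inhabited (naked-singularity datum superposed with a distant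
collapsing region by localized gluing) with positive codimension. [difficulty: open-problem] (why it
might fail: a tame-open set of admissible vacuum data whose MGHD traps a sphere AND forms a naked
singularity outside the resulting black hole (smooth-data analogue of the Hölder-class stability
arXiv:2605.16235), or incompleteness of 𝓘⁺ generated by the black-hole region itself on an open
set.) [doi:10.1088/0264-9381/22/11/019, arXiv:2402.10190, arXiv:2211.15742, arXiv:1912.08478,
arXiv:2204.09891, arXiv:1407.4766, arXiv:2605.16235, Christodoulou1999]
#4 TrappedExtremalExit (crux) — PIECE 𝓣₃ — TrappedExtremalExit [WEAKER·COUNTS·SPECIAL-TYPE — critic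
CLEARED 2026-08-30T02:40:09Z; generic THIRD LAW after trapping (transversal crossing of |a_f|/M_f =
1 along a tame line) + pointwise C⁰→C² upgrade at sub-extremal members (content pinned by
stmt-FinalStateConjecture-17298 SubextremalUpgrade, cited by name); MODEL-ANALOGUE in print not a
rung (arXiv:2211.15742 Thm 1); INSTRUMENTABLE (remnant-spin census); BARRIER AretakisInstability
OUTSIDE (asks to leave the cell)]. For every Σ and every admissible P_Σ-exceptional datum d, not of
dispersive type, all of whose MGHDs contain a closed trapped sphere to the future of the data, and
which SATISFIES the weak C⁰ property P_w⁰ (an MGHD exists; every MGHD has complete 𝓘⁺ and an honest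
C⁰ Kerr final-state decomposition with |a_i| ≤ M_i and the Statement's four clauses) — so that,
given the registered pointwise upgrade stmt-17298, d fails P_Σ exactly because one of its MGHDs has
only end states with an exactly extremal hole — there are one end e and a tame immersed injective
one-parameter family F of admissible data with F 0 = d whose members c ≠ 0 satisfy P_Σ. Content: the
generic third law after trapping (final |a_f|/M_f = 1 met transversally along a tame curve) + the
C⁰→C² upgrade at the sub-extremal members (stmt-17298, pointwise). [difficulty: open-problem] (why
it might fail: the set of trapped data with exactly extremal remnants could be tame-thick
(accumulating on itself along every tame line through a member), or every tame exit from it could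
pass through uncensored data; vacuum extremal Kerr formation itself is open (arXiv:2402.10190
p.12).) [arXiv:2211.15742, arXiv:2402.10190, arXiv:2304.08455, Aretakis2015, arXiv:1402.7034,
Israel1986]
#5 ExtremalThresholdExit (crux) — = the BORN N2 item stmt-FinalStateConjecture-24765 reused BY
SIGNATURE (dedup-attach; critic ruling (α) 02:40:09Z), text as born: PIECE 𝓝∧P_w —
ExtremalThresholdExit [WEAKER·thin — critic CLEARED 2026-08-30T01:39:13Z with retag: the printed
Kehle–Unger exit family (arXiv:2402.10190 Thm 1, Einstein–Maxwell–Vlasov) is a MODEL-ANALOGUE, not a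
rung; leaf IDEA-NEEDED; BARRIER placement: AretakisInstability concerns settling ON the threshold,
this piece only asks to LEAVE it along a tame curve — outside; the bet is transversality of B_crit].
For every Σ and every admissible P_Σ-exceptional datum d of threshold type (not dispersive, not
trapped) which satisfies the WEAK property P_w (an MGHD exists; every MGHD has complete 𝓘⁺ and a
Kerr final state decomposition with all the Statement's clauses but only |aᵢ| ≤ Mᵢ — so d fails P_Σ
only through an exactly extremal final hole), there are one end e and a tame immersed injective
one-parameter family F of admissible data with F 0 = d whose members c ≠ 0 satisfy P_Σ. [difficulty:
open-problem] (why it might fail: the extremal critical set B_crit could be thick in the tame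
topology (extremal thresholds accumulating on themselves along every tame line), or leaving the
threshold could land in naked data; vacuum extremal formation itself is open (arXiv:2402.10190
p.12).) [arXiv:2402.10190, arXiv:2211.15742, arXiv:2304.08455]
#6 DispersiveExit (crux) — = the BORN N2 item stmt-FinalStateConjecture-24766 reused BY SIGNATURE
(dedup-attach; critic ruling (α) 02:40:09Z), text as born: PIECE 𝓒 — DispersiveExit [WEAKER·thin —
critic CLEARED 2026-08-30T01:39:13Z; implied outright by the registered pointwise item
stmt-FinalStateConjecture-17320 `NoParkingWithoutHorizon.CompleteSpacetimesDisperse` (lens kernel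
`dispersiveExit_of_completeSpacetimesDisperse`; cited by name, not re-typed); leaf IDEA-NEEDED;
attackable-now sub-rung: stationary-complete ⇒ flat (Lichnerowicz–Anderson port); rung stmt-10029
NoVacuumBreathers]. For every Σ and every admissible P_Σ-exceptional datum d of dispersive type (an
MGHD exists and every MGHD is future causally geodesically complete: no future null or timelike
geodesic incompleteness, stated under the metric's Levi-Civita instance), there are one end e and a
tame immersed injective one-parameter family F of admissible data with F 0 = d whose members c ≠ 0
satisfy P_Σ. [difficulty: open-problem] (why it might fail: a non-radiating vacuum breather or a
complete development with curvature not decaying at i⁺ whose tame neighbours are also exceptional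
(an open set) refutes it; no-breather results hold only near 𝓘 (arXiv:1504.04592) or for decaying
solutions (arXiv:2108.13379).) [arXiv:2108.13379, arXiv:1504.04592, doi:10.1007/PL00001021]
#7 NakedThresholdExit (crux) — = the BORN N2 item stmt-FinalStateConjecture-24767 reused BY
SIGNATURE (dedup-attach; critic ruling (α) 02:40:09Z), text as born: PIECE 𝓝∧¬P_w —
NakedThresholdExit [WEAKER·COUNTS — critic CLEARED 2026-08-30T01:39:13Z; = weak cosmic censorship on
the untrapped incomplete sector in Christodoulou's own codimension form (the all-cells version is
the registered hard core stmt-FinalStateConjecture-17269, cited; this is its cell restriction with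
cure target P_Σ); leaf IDEA-NEEDED; BARRIER: nakedSingularityInstability is the MODEL exit family
(Christodoulou1999 Thm 4.1, 2-plane of exits) = the generic form, outside the genericity-blind
class; functional-framework dependence (Singh–Zheng arXiv:2605.16235: Hölder-stable naked
singularities in the spherical scalar field) — the bet is that smooth tame data are on the unstable
side]. For every Σ and every admissible P_Σ-exceptional datum d of threshold type (not dispersive,
not trapped) failing even the weak property P_w (no MGHD, or an MGHD with incomplete 𝓘⁺, or censored
but settling to no Kerr configuration with |aᵢ| ≤ Mᵢ), there are one end e and a tame immersed
injective one-parameter family F of admissible data with F 0 = d whose members c ≠ 0 satisfy P_Σ.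
[difficulty: open-problem] (why it might fail: a smooth-data analogue of the Singh–Zheng stability —
a tame-open set of admissible vacuum data forming naked singularities (RSR arXiv:1912.08478
exteriors are fine-tuned, consistent so far).) [Christodoulou1999, arXiv:1912.08478,
arXiv:2204.09891, arXiv:2605.16235, arXiv:0811.0354]

TWO-LAYER PLAN. This route IS the second layer of N2's trapped basin promoted to a thin sibling
route (D-0019 two-layer rule: the parent route already carries the capture-axis cut TrappedWild +
PerturbativeCell of TrappedExit; a second active decomposition of the same node lives in a separate
route sharing the decls). Foreseen beneath TrappedCaptureExit (not filed, gen 3): the near-Kerr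
print-adjacent sub-population is deliberately NOT split off (decorative); 17296's own crux line is
the place for capture mechanisms. Lens-5's typed layer-2 of TrappedWild (EternalHoleCell ∧
TrappedNakedCell) is SUBSUMED here (critic ruling 02:40:09Z) and will not be filed separately.

KILL CRITERIA. All six binders are S-implied in the kernel, so a refutation of any of them (an open
set of exceptional data inside one cell: stable breather, stable hairy/extremal remnant family,
thick extremal threshold, tame-stable naked singularity) is a refutation of the summit AS TYPED — it
closes this route `refuted:<Decl>` and feeds the statement audit / refutation routes, not a pivot.
Mooted piecewise: DispersiveExit closes for free if stmt-17320 is proved (`cellExit_of_forall`).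
Superseded if a sibling root decomposition absorbs the four cells with strictly finer content.

NOT DECOMPOSED YET. TrappedCaptureExit's interior (large-data capture at C⁰, = 17296's programme)
and the censorship content of NakedThresholdExit are famous-grade and deliberately not decomposed at
birth; Penrose's theorem for developments (lens `PenroseForDevelopments`, to be discharged from
`Penrose1965_singularityTheorem` when `PenroseSingularityTheorem` builds) is descriptive only and
never a binder; constants (remnant spin margins) live in instruments, never in binders.

CHEAPEST FALSIFIER. DispersiveExit: a literature lookup for a complete, non-flat, non-radiating
asymptotically flat vacuum spacetime (a vacuum breather / geon) — none known (Alexakis–Schlue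
exclude time-periodic far fields; Lichnerowicz–Anderson: complete + static/stationary ⇒ flat).
ExtremalThresholdExit: does any fine-tuned one-parameter vacuum collapse family in numerical
relativity approach |a_f|/M_f → 1 at threshold WITH an open neighbourhood of extremal outcomes
(thick B_crit)? — unrun (kit_allowed = false for the writer; census test T-2 stated).
NakedThresholdExit: a printed tame-open naked-singularity family in vacuum (none; RSR fine-tuned).
TrappedExit: NR catalogues (SXS arXiv:1904.04831) show remnant spins ≤ 0.95 on open sets —
consistent; a kill needs an open trapped family with |a_f|/M_f → 1 or permanent hair.

NUMBERS. Print only: binary-merger remnants |a_f|/M_f ≲ 0.95 (SXS catalogue arXiv:1904.04831);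
vacuum gluing produces extremal-horizon formation only for |a|/M ≤ a₀ ≪ 1 so far (arXiv:2304.08455);
Choptuik-type threshold scaling in the charged model (arXiv:2402.10190). No constant enters a
binder.

DEFINITION REQUESTS. None filed. DEDUP NOTE: `Disp`/`Trap` inline the lens's
`DevelopmentIsComplete`/`DevelopmentTraps`, themselves phrased on the registered items
`ConcentrationCannotWait.RegularCompleteDisperses` (stmt-17276) /
`NoNullFinalMomentum.TrappedImpliesMassive`; the instance binder `∀ [𝒟.metric.HasLeviCivita]` is
inhabited (`LeviCivitaProofs.hasLeviCivita`, critic check on lens-6) so the cells are not vacuous.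
Shared Frame for CellExit/CellEsc (critic must-fix 1) concerns the HOME node files; route items stay
self-contained one-liners.

Novelty: GEN-2 (2026-08-30T02:4xZ, lens-2 + critic + writer): nearest in-tree = route GlobalAttraction
(stmt-17296 CensoredExteriorsSettle, 17298 SubextremalUpgrade — ∀-data architecture; this file is
its S-implied cell-ification on the trapped basin, citing both by name) and the parent N2
(route-FinalStateConjecture-RootDecompCausalCells) whose trapped cell it refines; lens-5
TrappingTimeCells (capture-axis cut, filed on the parent) is the transversal cut.
Searches (2026-08-30, lens-2 + writer): the 60 Theses files of the sub read for sector/cell splits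
(nearest: NoParkingWithoutHorizon, ConcentrationCannotWait, NoNullFinalMomentum — all-data sector
splits with pointwise pieces); lit search --hybrid "extremal critical collapse third law" and
"Cauchy stability closed trapped surface" ([corpus:arxiv-2402.10190 p.1,4,11,12],
[corpus:arxiv-2108.13379 p.3], [corpus:arxiv-1504.04592 p.1], [corpus:arxiv-2605.16235 pp.2–4],
[corpus:arxiv-2606.28253 p.1]); lit galaxy search "extremal critical collapse|third law" --star all
and "Cauchy stability|closed trapped surface" --star all ([galaxy:pdf:-3174327065217227160]
Kehle–Unger third law; otherwise textbook hits, none with a population split of an exceptional set);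
writer's searches for N5 (lit search --hybrid "orbital stability asymptotic stability Kerr final
state generic data extremal third law", 8 docs; lit galaxy search "orbitally stable|orbital
stability of Kerr|final state conjecture" --star all, 17 rows, no mechanism hit); ledger negativ  [refs: 10.1103/PhysRevLett.14.57, 2402.10190, arxiv-2402.10190, arxiv-2108.13379, arxiv-1504.04592, arxiv-2605.16235, arxiv-2606.28253, doi:10.1103/PhysRevLett.14.57]

Barriers (technique_class: population-split, penrose-trichotomy, third-law): - technique_class: population-split, penrose-trichotomy, third-law
- Literature.Barriers.FinalStateConjecture.nakedSingularityInstability: genericity-blind methods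
excluded; NakedThresholdExit / TrappedNakedExit / all pieces are the GENERIC (tame-curve) forms —
outside the class; the barrier's own theorem (Christodoulou 1999 Thm 4.1) is the model exit family.
- Literature.Barriers.FinalStateConjecture.AretakisInstability: bites settling ON an extremal
horizon and every uniform-in-spin road inside TrappedCaptureExit; ExtremalThresholdExit and
TrappedExtremalExit only ask to LEAVE the extremal cell along a tame curve — outside (critic
placement 02:40:09Z); inside TrappedCaptureExit near-extremal capture roads it is declared, not
evaded.
- Literature.Barriers.FinalStateConjecture.SlowlyRotatingKerrFrontier: printed near-Kerr basins are
NOT split off as a cell (a theorem-cell would be decorative); TrappedCaptureExit's closing as typed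
needs the full range — inside the frontier's shadow for roads, acknowledged.
- Literature.Barriers.FinalStateConjecture.KerrSuperradiance: decay-estimate barrier for linear
roads inside TrappedCaptureExit; the binders are data-side exit statements — outside for the
statements, inside for every decay road (DRSR currents needed).
- Literature.Barriers.FinalStateConjecture.SbierskiTrappingObstruction: derivative loss at trapping;
no decay rate is typed in any item — outside for statements, inside for decay roads.
- Literature.Barriers.FinalStateConject

sub-problem: FinalStateConjecture · status: draft · opened planner-decomp-fsc-writer-1-g0-0 2026-08-30T02:43:41Z · rev 1 · ledger route-FinalStateConjecture-RootDecompTrappedBasinCells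
GENERATED by the gate from the ledger (D-0016/17). Provers cite these decls: `theorem foo : Summit.FinalStateConjecture.FinalStateConjecture.Theses.RootDecompTrappedBasinCells.<Decl> := …` in Summits/FinalStateConjecture/FinalStateConjecture/Theorems/<Name>.lean.
-/

namespace Summit.FinalStateConjecture.FinalStateConjecture.Theses.RootDecompTrappedBasinCells

open scoped BigOperators Topology Manifold Classical MeasureTheory ProbabilityTheory Matrix InnerProductSpace ComplexConjugate ContinuousMap
open Filter Set Function TopologicalSpace MeasureTheory

attribute [summit_statement] _root_.FinalStateConjecture

/-- item stmt-FinalStateConjecture-25597 · crux · rank 2 · SPLIT (gen 1) into SingleHoleCaptureExit, MultiHoleCaptureExit, InfiniteHoleCaptureExit + glue TrappedCaptureExitGlue · direct attempts still welcome (low priority) · by planner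
why it might fail: a tame-open set of trapped admissible data with censored, never C⁰-settling exteriors — smooth non-Kerr stationary vacuum hair, an eternal floating bound companion outside the horizon, or a Burnett-type high-frequency tail not even C⁰-settled.
sources: arXiv:2606.28253, KlainermanSzeftel2023, GiorgiKlainermanSzeftel2022, arXiv:0904.0982, arXiv:1710.01722, arXiv:2009.08968
[crux] PIECE 𝓣₂ — TrappedCaptureExit [WEAKER·RESIDUAL-relieved·GENERIC-TYPE — critic CLEARED
2026-08-30T02:40:09Z; NEW RESIDUAL of the trapped basin (capture + rigidity + no eternal radiation
at C⁰ for censored collapsed data); implied outright by the registered ∀-data item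
stmt-FinalStateConjecture-17296 GlobalAttraction.CensoredExteriorsSettle (cited by name, its crux
line Cruxes/CensoredExteriorsSettle not re-cut); hard cores stmt-17308 / stmt-10745 live here; leaf
IDEA-NEEDED + INSTRUMENTABLE]. For every Σ and every admissible P_Σ-exceptional datum d, not of
dispersive type, all of whose MGHDs contain a closed trapped sphere to the future of the data, ALL
of whose MGHDs have complete future null infinity, and which fails the weak C⁰ property P_w⁰ (some
MGHD admits no honest C⁰ Kerr final-state decomposition with |a_i| ≤ M_i, O = exteriorOf,
RaysStayInClosure, HasExhaustiveCharts, IsFutureOriented), there are one end e and a tame (order 1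
at e), immersed-at-0, injective one-parameter family F of admissible data with F 0 = d all of whose
members c ≠ 0 satisfy P_Σ. Content: large-data capture + rigidity without analyticity + no eternally
radiating censored exteriors, at C⁰; implie -/
@[route_item "route-FinalStateConjecture-RootDecompTrappedBasinCells", crux]
def TrappedCaptureExit : Prop :=
  ∀ (X : Type) [TopologicalSpace X] [ChartedSpace Literature.Geometry.Lorentzian.E3 X] [IsManifold (𝓡 3) ((⊤ : ℕ∞) : WithTop ℕ∞) X] [T2Space X] [SecondCountableTopology X] [ConnectedSpace X], let P : Literature.Geometry.Lorentzian.InitialDataSet (𝓡 3) X → Prop := fun D ↦ (∃ 𝒟 : Literature.Geometry.Lorentzian.VacuumCauchyDevelopment D, 𝒟.IsMaximal) ∧ ∀ 𝒟 : Literature.Geometry.Lorentzian.VacuumCauchyDevelopment D, 𝒟.IsMaximal → Summit.FinalStateConjecture.HasCompleteNullInfinity 𝒟.toCauchyDevelopment ∧ ∃ (O : Set 𝒟.carrier) (d : Literature.Geometry.Lorentzian.FinalStateDecomposition 𝒟.toSpacetime O 2), (∀ i, Literature.Geometry.Lorentzian.Kerr.IsSubextremal (d.mass i) (d.spin i)) ∧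 O = Summit.FinalStateConjecture.exteriorOf 𝒟.toCauchyDevelopment d.charted ∧ Summit.FinalStateConjecture.RaysStayInClosure 𝒟.toCauchyDevelopment O ∧ Summit.FinalStateConjecture.HasExhaustiveCharts d ∧ Summit.FinalStateConjecture.IsFutureOriented d; let Pw0 : Literature.Geometry.Lorentzian.InitialDataSet (𝓡 3) X → Prop := fun D ↦ (∃ 𝒟 : Literature.Geometry.Lorentzian.VacuumCauchyDevelopment D, 𝒟.IsMaximal) ∧ ∀ 𝒟 : Literature.Geometry.Lorentzian.VacuumCauchyDevelopment D, 𝒟.IsMaximal → Summit.FinalStateConjecture.HasCompleteNullInfinity 𝒟.toCauchyDevelopment ∧ ∃ (O : Set 𝒟.carrier) (d : Literature.Geometry.Lorentzian.FinalStateDecomposition 𝒟.toSpacetime O 0), O = Summit.FinalStateConjecture.exteriorOf 𝒟.toCauchyDevelopment d.charted ∧ Summit.FinalStateConjecture.RaysStayInClosure 𝒟.toCauchyDevelopment O ∧ Summit.FinalStateConjecture.HasExhaustiveCharts d ∧ Summit.FinalStateConjecture.IsFutureOriented d; let Disp : Literature.Geometry.Lorentzian.InitialDataSet (𝓡 3)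 X → Prop := fun D ↦ (∃ 𝒟 : Literature.Geometry.Lorentzian.VacuumCauchyDevelopment D, 𝒟.IsMaximal) ∧ ∀ 𝒟 : Literature.Geometry.Lorentzian.VacuumCauchyDevelopment D, 𝒟.IsMaximal → ∀ [𝒟.metric.HasLeviCivita], ¬ 𝒟.metric.IsFutureNullGeodesicallyIncomplete 𝒟.timeOrientation ∧ ¬ 𝒟.metric.IsFutureTimelikeGeodesicallyIncomplete 𝒟.timeOrientation; let Trap : Literature.Geometry.Lorentzian.InitialDataSet (𝓡 3) X → Prop := fun D ↦ (∃ 𝒟 : Literature.Geometry.Lorentzian.VacuumCauchyDevelopment D, 𝒟.IsMaximal) ∧ ∀ 𝒟 : Literature.Geometry.Lorentzian.VacuumCauchyDevelopment D, 𝒟.IsMaximal → ∀ [𝒟.metric.HasLeviCivita], ∃ f : Metric.sphere (0 : Literature.Geometry.Lorentzian.E3) 1 → 𝒟.carrier, Set.range f ⊆ 𝒟.metric.causalFuture 𝒟.timeOrientation (Set.range 𝒟.embed) ∧ 𝒟.metric.IsTrappedSurface (𝓡 2) 𝒟.timeOrientation f; let Cens : Literature.Geometry.Lorentzian.InitialDataSet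 (𝓡 3) X → Prop := fun D ↦ ∀ 𝒟 : Literature.Geometry.Lorentzian.VacuumCauchyDevelopment D, 𝒟.IsMaximal → Summit.FinalStateConjecture.HasCompleteNullInfinity 𝒟.toCauchyDevelopment; ∀ d ∈ Literature.Geometry.Lorentzian.admissibleVacuumData X, ¬ P d → (¬ Disp d ∧ Trap d ∧ Cens d ∧ ¬ Pw0 d) → ∃ (e : Literature.Geometry.Lorentzian.AFEnd X) (F : EuclideanSpace ℝ (Fin 1) → Literature.Geometry.Lorentzian.InitialDataSet (𝓡 3) X), Literature.Geometry.Lorentzian.InitialDataSet.IsTameDataFamily e 1 F ∧ Literature.Geometry.Lorentzian.InitialDataSet.IsImmersedAtZero 1 F ∧ F 0 = d ∧ Injective F ∧ (∀ c, F c ∈ Literature.Geometry.Lorentzian.admissibleVacuumData X) ∧ ∀ c ≠ 0, P (F c)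

-- parent: TrappedCaptureExit · child (gen 1)
/--     item stmt-FinalStateConjecture-26645 · crux · rank 201 · open
    parent: TrappedCaptureExit · by planner
    why it might fail: A tame-open set of trapped, censored admissible data forming ONE hole whose exterior never C⁰-settles to Kerr: smooth non-Kerr stationary hair with connected horizon (rigidity without analyticity is open), or a non-decaying high-frequency tail (Burnett-type), would refute it.
    sources: arXiv:2606.28253, KlainermanSzeftel2023, GiorgiKlainermanSzeftel2022, DafermosHolzegelRodnianskiTaylor2021, arXiv:0902.1173, arXiv:1710.01722
[crux · child 𝓣₂¹ of TrappedCaptureExit · NEW RESIDUAL · GENERIC-TYPE; CLEARED by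
decomp-fsc-crit-1-g0 2026-08-30T03:23:32Z (k = 3 chosen); writer glue/exactness
folder/n2bg3/Sketch.lean rc 0 / 0 sorry.] For every Σ and every admissible P_Σ-exceptional datum d
of the capture cell 𝓣₂ (not of dispersive type; every MGHD contains a closed trapped sphere in the
causal future of the data; every MGHD has complete future null infinity; d fails the weak C⁰
property P_w⁰) ALL of whose MGHDs 𝒟 end with AT MOST ONE black hole — the future black-hole region
𝓑⁺(𝒟) = blackHoleRegion 𝒟 ∩ J⁺(range 𝒟.embed) (EventHorizon.lean vocabulary; = J⁺(ιΣ) minus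
exteriorOf 𝒟 (completeNullRayRegion 𝒟)) has at most one connected component (Subsingleton
(ConnectedComponents ↥𝓑⁺), i.e. 𝓑⁺ preconnected; standing instance [HasLeviCivita] bound innermost
as in CauchyDevelopment.lean) — there are one end e and a tame (order 1 at e), immersed-at-0,
injective one-parameter family F of admissible data with F 0 = d all of whose members c ≠ 0 satisfy
P_Σ. Content: the ONE-HOLE endgame at C⁰ (large-data capture of a single censored collapsed system,
rigidity of a connected-horizon stationary end state without analyticity, -/
@[route_item "route-FinalStateConjecture-RootDecompTrappedBasinCells"]
def SingleHoleCaptureExit : Prop :=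
  ∀ (X : Type) [TopologicalSpace X] [ChartedSpace Literature.Geometry.Lorentzian.E3 X] [IsManifold (𝓡 3) ((⊤ : ℕ∞) : WithTop ℕ∞) X] [T2Space X] [SecondCountableTopology X] [ConnectedSpace X], let P : Literature.Geometry.Lorentzian.InitialDataSet (𝓡 3) X → Prop := fun D ↦ (∃ 𝒟 : Literature.Geometry.Lorentzian.VacuumCauchyDevelopment D, 𝒟.IsMaximal) ∧ ∀ 𝒟 : Literature.Geometry.Lorentzian.VacuumCauchyDevelopment D, 𝒟.IsMaximal → Summit.FinalStateConjecture.HasCompleteNullInfinity 𝒟.toCauchyDevelopment ∧ ∃ (O : Set 𝒟.carrier) (d : Literature.Geometry.Lorentzian.FinalStateDecomposition 𝒟.toSpacetime O 2), (∀ i, Literature.Geometry.Lorentzian.Kerr.IsSubextremal (d.mass i) (d.spin i)) ∧ O = Summit.FinalStateConjecture.exteriorOf 𝒟.toCauchyDevelopment d.charted ∧ Summit.FinalStateConjecture.RaysStayInClosure 𝒟.toCauchyDevelopment O ∧ Summit.FinalStateConjecture.HasExhaustiveCharts d ∧ Summit.FinalStateConjecture.IsFutureOriented d; let Pw0 : Literature.Geometry.Lorentzian.InitialDataSet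 (𝓡 3) X → Prop := fun D ↦ (∃ 𝒟 : Literature.Geometry.Lorentzian.VacuumCauchyDevelopment D, 𝒟.IsMaximal) ∧ ∀ 𝒟 : Literature.Geometry.Lorentzian.VacuumCauchyDevelopment D, 𝒟.IsMaximal → Summit.FinalStateConjecture.HasCompleteNullInfinity 𝒟.toCauchyDevelopment ∧ ∃ (O : Set 𝒟.carrier) (d : Literature.Geometry.Lorentzian.FinalStateDecomposition 𝒟.toSpacetime O 0), O = Summit.FinalStateConjecture.exteriorOf 𝒟.toCauchyDevelopment d.charted ∧ Summit.FinalStateConjecture.RaysStayInClosure 𝒟.toCauchyDevelopment O ∧ Summit.FinalStateConjecture.HasExhaustiveCharts d ∧ Summit.FinalStateConjecture.IsFutureOriented d; let Disp : Literature.Geometry.Lorentzian.InitialDataSet (𝓡 3) X → Prop := fun D ↦ (∃ 𝒟 : Literature.Geometry.Lorentzian.VacuumCauchyDevelopment D, 𝒟.IsMaximal) ∧ ∀ 𝒟 : Literature.Geometry.Lorentzian.VacuumCauchyDevelopment D, 𝒟.IsMaximal → ∀ [𝒟.metric.HasLeviCivita], ¬ 𝒟.metric.IsFutureNullGeodesicallyIncomplete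 𝒟.timeOrientation ∧ ¬ 𝒟.metric.IsFutureTimelikeGeodesicallyIncomplete 𝒟.timeOrientation; let Trap : Literature.Geometry.Lorentzian.InitialDataSet (𝓡 3) X → Prop := fun D ↦ (∃ 𝒟 : Literature.Geometry.Lorentzian.VacuumCauchyDevelopment D, 𝒟.IsMaximal) ∧ ∀ 𝒟 : Literature.Geometry.Lorentzian.VacuumCauchyDevelopment D, 𝒟.IsMaximal → ∀ [𝒟.metric.HasLeviCivita], ∃ f : Metric.sphere (0 : Literature.Geometry.Lorentzian.E3) 1 → 𝒟.carrier, Set.range f ⊆ 𝒟.metric.causalFuture 𝒟.timeOrientation (Set.range 𝒟.embed) ∧ 𝒟.metric.IsTrappedSurface (𝓡 2) 𝒟.timeOrientation f; let Cens : Literature.Geometry.Lorentzian.InitialDataSet (𝓡 3) X → Prop := fun D ↦ ∀ 𝒟 : Literature.Geometry.Lorentzian.VacuumCauchyDevelopment D, 𝒟.IsMaximal → Summit.FinalStateConjecture.HasCompleteNullInfinity 𝒟.toCauchyDevelopment; let Single : Literature.Geometry.Lorentzian.InitialDataSet (𝓡 3) X → Prop := fun D ↦ ∀ 𝒟 : Literature.Geometry.Lorentzian.VacuumCauchyDevelopment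 D, 𝒟.IsMaximal → ∀ [𝒟.metric.HasLeviCivita], Subsingleton (ConnectedComponents ↥(Literature.Geometry.Lorentzian.DataEmbedding.blackHoleRegion 𝒟.toDataEmbedding ∩ 𝒟.metric.causalFuture 𝒟.timeOrientation (Set.range 𝒟.embed))); ∀ d ∈ Literature.Geometry.Lorentzian.admissibleVacuumData X, ¬ P d → ((¬ Disp d ∧ Trap d ∧ Cens d ∧ ¬ Pw0 d) ∧ Single d) → ∃ (e : Literature.Geometry.Lorentzian.AFEnd X) (F : EuclideanSpace ℝ (Fin 1) → Literature.Geometry.Lorentzian.InitialDataSet (𝓡 3) X), Literature.Geometry.Lorentzian.InitialDataSet.IsTameDataFamily e 1 F ∧ Literature.Geometry.Lorentzian.InitialDataSet.IsImmersedAtZero 1 F ∧ F 0 = d ∧ Injective F ∧ (∀ c, F c ∈ Literature.Geometry.Lorentzian.admissibleVacuumData X) ∧ ∀ c ≠ 0, P (F c)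

-- parent: TrappedCaptureExit · child (gen 1)
/--     item stmt-FinalStateConjecture-26646 · crux · rank 202 · open
    parent: TrappedCaptureExit · by planner
    why it might fail: A tame-open set of admissible data whose MGHD keeps two holes on an eternal quasi-periodic censored orbit (a vacuum 'floating' binary), or n ≥ 3 co-axial multi-Kerr(–NUT) equilibria that exist AND are attained from an open set, would refute it; n ≥ 3 non-existence is open (CCH12 p.14).
    sources: doi:10.1007/BF00770326, arXiv:0905.4179, arXiv:1103.5248, arXiv:1105.5830, arXiv:1111.1448, arXiv:0811.1727
[crux · child 𝓣₂² of TrappedCaptureExit · SPECIAL-TYPE (configurational) · INSTRUMENTABLE; CLEARED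
by decomp-fsc-crit-1-g0 2026-08-30T03:23:32Z (k = 3 chosen); writer glue/exactness
folder/n2bg3/Sketch.lean rc 0 / 0 sorry.] For every Σ and every admissible P_Σ-exceptional datum d
of the capture cell 𝓣₂ (not of dispersive type; every MGHD contains a closed trapped sphere in the
causal future of the data; every MGHD has complete future null infinity; d fails the weak C⁰
property P_w⁰) SOME of whose MGHDs ends with AT LEAST TWO black holes (𝓑⁺ not preconnected) and ALL
of whose MGHDs end with FINITELY MANY (Finite (ConnectedComponents ↥𝓑⁺)), there are one end e and a
tame (order 1 at e), immersed-at-0, injective one-parameter family F of admissible data with F 0 = d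
all of whose members c ≠ 0 satisfy P_Σ. Content = the generic MANY-BODY sector of the capture
problem: (i) no eternal non-merging bound binary with censored exterior (radiative dissipation),
(ii) no stationary n-horizon vacuum equilibrium to park at (static: Bunting–Masood-ul-Alam 1987,
Beig–Gibbons–Schoen 2009; n = 2 stationary: Neugebauer–Hennig + Chruściel et al., CCH12 Thm 3.6; n ≥
3 widely open), (iii) capture of each -/
@[route_item "route-FinalStateConjecture-RootDecompTrappedBasinCells"]
def MultiHoleCaptureExit : Prop :=
  ∀ (X : Type) [TopologicalSpace X] [ChartedSpace Literature.Geometry.Lorentzian.E3 X] [IsManifold (𝓡 3) ((⊤ : ℕ∞) : WithTop ℕ∞) X] [T2Space X] [SecondCountableTopology X] [ConnectedSpace X], let P : Literature.Geometry.Lorentzian.InitialDataSet (𝓡 3) X → Prop := fun D ↦ (∃ 𝒟 : Literature.Geometry.Lorentzian.VacuumCauchyDevelopment D, 𝒟.IsMaximal) ∧ ∀ 𝒟 : Literature.Geometry.Lorentzian.VacuumCauchyDevelopment D, 𝒟.IsMaximal → Summit.FinalStateConjecture.HasCompleteNullInfinity 𝒟.toCauchyDevelopment ∧ ∃ (O :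 Set 𝒟.carrier) (d : Literature.Geometry.Lorentzian.FinalStateDecomposition 𝒟.toSpacetime O 2), (∀ i, Literature.Geometry.Lorentzian.Kerr.IsSubextremal (d.mass i) (d.spin i)) ∧ O = Summit.FinalStateConjecture.exteriorOf 𝒟.toCauchyDevelopment d.charted ∧ Summit.FinalStateConjecture.RaysStayInClosure 𝒟.toCauchyDevelopment O ∧ Summit.FinalStateConjecture.HasExhaustiveCharts d ∧ Summit.FinalStateConjecture.IsFutureOriented d; let Pw0 : Literature.Geometry.Lorentzian.InitialDataSet (𝓡 3) X → Prop := fun D ↦ (∃ 𝒟 : Literature.Geometry.Lorentzian.VacuumCauchyDevelopment D, 𝒟.IsMaximal) ∧ ∀ 𝒟 : Literature.Geometry.Lorentzian.VacuumCauchyDevelopment D, 𝒟.IsMaximal → Summit.FinalStateConjecture.HasCompleteNullInfinity 𝒟.toCauchyDevelopment ∧ ∃ (O : Set 𝒟.carrier) (d : Literature.Geometry.Lorentzian.FinalStateDecomposition 𝒟.toSpacetime O 0), O = Summit.FinalStateConjecture.exteriorOf 𝒟.toCauchyDevelopment d.charted ∧ Summit.FinalStateConjecture.RaysStayInClosure 𝒟.toCauchyDevelopment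 O ∧ Summit.FinalStateConjecture.HasExhaustiveCharts d ∧ Summit.FinalStateConjecture.IsFutureOriented d; let Disp : Literature.Geometry.Lorentzian.InitialDataSet (𝓡 3) X → Prop := fun D ↦ (∃ 𝒟 : Literature.Geometry.Lorentzian.VacuumCauchyDevelopment D, 𝒟.IsMaximal) ∧ ∀ 𝒟 : Literature.Geometry.Lorentzian.VacuumCauchyDevelopment D, 𝒟.IsMaximal → ∀ [𝒟.metric.HasLeviCivita], ¬ 𝒟.metric.IsFutureNullGeodesicallyIncomplete 𝒟.timeOrientation ∧ ¬ 𝒟.metric.IsFutureTimelikeGeodesicallyIncomplete 𝒟.timeOrientation; let Trap : Literature.Geometry.Lorentzian.InitialDataSet (𝓡 3) X → Prop := fun D ↦ (∃ 𝒟 : Literature.Geometry.Lorentzian.VacuumCauchyDevelopment D, 𝒟.IsMaximal) ∧ ∀ 𝒟 : Literature.Geometry.Lorentzian.VacuumCauchyDevelopment D, 𝒟.IsMaximal → ∀ [𝒟.metric.HasLeviCivita], ∃ f : Metric.sphere (0 : Literature.Geometry.Lorentzian.E3) 1 → 𝒟.carrier, Set.range f ⊆ 𝒟.metric.causalFuture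 𝒟.timeOrientation (Set.range 𝒟.embed) ∧ 𝒟.metric.IsTrappedSurface (𝓡 2) 𝒟.timeOrientation f; let Cens : Literature.Geometry.Lorentzian.InitialDataSet (𝓡 3) X → Prop := fun D ↦ ∀ 𝒟 : Literature.Geometry.Lorentzian.VacuumCauchyDevelopment D, 𝒟.IsMaximal → Summit.FinalStateConjecture.HasCompleteNullInfinity 𝒟.toCauchyDevelopment; let Single : Literature.Geometry.Lorentzian.InitialDataSet (𝓡 3) X → Prop := fun D ↦ ∀ 𝒟 : Literature.Geometry.Lorentzian.VacuumCauchyDevelopment D, 𝒟.IsMaximal → ∀ [𝒟.metric.HasLeviCivita], Subsingleton (ConnectedComponents ↥(Literature.Geometry.Lorentzian.DataEmbedding.blackHoleRegion 𝒟.toDataEmbedding ∩ 𝒟.metric.causalFuture 𝒟.timeOrientation (Set.range 𝒟.embed))); let FinMany : Literature.Geometry.Lorentzian.InitialDataSet (𝓡 3) X → Prop := fun D ↦ ∀ 𝒟 : Literature.Geometry.Lorentzian.VacuumCauchyDevelopment D, 𝒟.IsMaximal → ∀ [𝒟.metric.HasLeviCivita], Finite (ConnectedComponents ↥(Literature.Geometry.Lorentzian.DataEmbedding.blackHoleRegion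 𝒟.toDataEmbedding ∩ 𝒟.metric.causalFuture 𝒟.timeOrientation (Set.range 𝒟.embed))); ∀ d ∈ Literature.Geometry.Lorentzian.admissibleVacuumData X, ¬ P d → ((¬ Disp d ∧ Trap d ∧ Cens d ∧ ¬ Pw0 d) ∧ ¬ Single d ∧ FinMany d) → ∃ (e : Literature.Geometry.Lorentzian.AFEnd X) (F : EuclideanSpace ℝ (Fin 1) → Literature.Geometry.Lorentzian.InitialDataSet (𝓡 3) X), Literature.Geometry.Lorentzian.InitialDataSet.IsTameDataFamily e 1 F ∧ Literature.Geometry.Lorentzian.InitialDataSet.IsImmersedAtZero 1 F ∧ F 0 = d ∧ Injective F ∧ (∀ c, F c ∈ Literature.Geometry.Lorentzian.admissibleVacuumData X) ∧ ∀ c ≠ 0, P (F c)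

-- parent: TrappedCaptureExit · child (gen 1)
/--     item stmt-FinalStateConjecture-26647 · crux · rank 203 · open
    parent: TrappedCaptureExit · by planner
    why it might fail: Late-time tails refocusing through an already formed hole's strong field (caustics near photon spheres) could keep forming ever smaller holes at ever later times on a tame-open set; no statement either way is in print (arXiv:2210.13960 p.6).
    sources: arXiv:0805.3880, arXiv:1409.6270, Christodoulou1999, arXiv:0811.0354, arXiv:2210.13960, HawkingEllis1973
[crux · child 𝓣₂^∞ of TrappedCaptureExit · thin · conjecturally EMPTY · IDEA-NEEDED; CLEARED by
decomp-fsc-crit-1-g0 2026-08-30T03:23:32Z (k = 3 chosen); writer glue/exactness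
folder/n2bg3/Sketch.lean rc 0 / 0 sorry.] For every Σ and every admissible P_Σ-exceptional datum d
of the capture cell 𝓣₂ (not of dispersive type; every MGHD contains a closed trapped sphere in the
causal future of the data; every MGHD has complete future null infinity; d fails the weak C⁰
property P_w⁰) SOME of whose MGHDs ends with INFINITELY MANY black holes (¬ Finite
(ConnectedComponents ↥𝓑⁺)), there are one end e and a tame (order 1 at e), immersed-at-0, injective
one-parameter family F of admissible data with F 0 = d all of whose members c ≠ 0 satisfy P_Σ. It
isolates the clause «N : ℕ» (finitely many hole charts) of FinalStateDecomposition inside the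
censored trapped basin. Kill path: a quantitative converse of trapped-surface formation (no closed
trapped surface in a region uniformly C¹-close to Minkowski) + late-time decay of the exterior field
⟹ no hole forms after some slab ⟹ finitely many components; classical vacuum has no mass gap
(Christodoulou short pulse arXiv:0805.3880, An–Luk arXiv:1409.627 -/
@[route_item "route-FinalStateConjecture-RootDecompTrappedBasinCells"]
def InfiniteHoleCaptureExit : Prop :=
  ∀ (X : Type) [TopologicalSpace X] [ChartedSpace Literature.Geometry.Lorentzian.E3 X] [IsManifold (𝓡 3) ((⊤ : ℕ∞) : WithTop ℕ∞) X] [T2Space X] [SecondCountableTopology X] [ConnectedSpace X], let P : Literature.Geometry.Lorentzian.InitialDataSet (𝓡 3) X → Prop := fun D ↦ (∃ 𝒟 : Literature.Geometry.Lorentzian.VacuumCauchyDevelopment D, 𝒟.IsMaximal) ∧ ∀ 𝒟 : Literature.Geometry.Lorentzian.VacuumCauchyDevelopment D, 𝒟.IsMaximal → Summit.FinalStateConjecture.HasCompleteNullInfinity 𝒟.toCauchyDevelopment ∧ ∃ (O : Set 𝒟.carrier) (d : Literature.Geometry.Lorentzian.FinalStateDecomposition 𝒟.toSpacetime O 2),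 (∀ i, Literature.Geometry.Lorentzian.Kerr.IsSubextremal (d.mass i) (d.spin i)) ∧ O = Summit.FinalStateConjecture.exteriorOf 𝒟.toCauchyDevelopment d.charted ∧ Summit.FinalStateConjecture.RaysStayInClosure 𝒟.toCauchyDevelopment O ∧ Summit.FinalStateConjecture.HasExhaustiveCharts d ∧ Summit.FinalStateConjecture.IsFutureOriented d; let Pw0 : Literature.Geometry.Lorentzian.InitialDataSet (𝓡 3) X → Prop := fun D ↦ (∃ 𝒟 : Literature.Geometry.Lorentzian.VacuumCauchyDevelopment D, 𝒟.IsMaximal) ∧ ∀ 𝒟 : Literature.Geometry.Lorentzian.VacuumCauchyDevelopment D, 𝒟.IsMaximal → Summit.FinalStateConjecture.HasCompleteNullInfinity 𝒟.toCauchyDevelopment ∧ ∃ (O : Set 𝒟.carrier) (d : Literature.Geometry.Lorentzian.FinalStateDecomposition 𝒟.toSpacetime O 0), O = Summit.FinalStateConjecture.exteriorOf 𝒟.toCauchyDevelopment d.charted ∧ Summit.FinalStateConjecture.RaysStayInClosure 𝒟.toCauchyDevelopment O ∧ Summit.FinalStateConjecture.HasExhaustiveCharts d ∧ Summit.FinalStateConjecture.IsFutureOriented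 d; let Disp : Literature.Geometry.Lorentzian.InitialDataSet (𝓡 3) X → Prop := fun D ↦ (∃ 𝒟 : Literature.Geometry.Lorentzian.VacuumCauchyDevelopment D, 𝒟.IsMaximal) ∧ ∀ 𝒟 : Literature.Geometry.Lorentzian.VacuumCauchyDevelopment D, 𝒟.IsMaximal → ∀ [𝒟.metric.HasLeviCivita], ¬ 𝒟.metric.IsFutureNullGeodesicallyIncomplete 𝒟.timeOrientation ∧ ¬ 𝒟.metric.IsFutureTimelikeGeodesicallyIncomplete 𝒟.timeOrientation; let Trap : Literature.Geometry.Lorentzian.InitialDataSet (𝓡 3) X → Prop := fun D ↦ (∃ 𝒟 : Literature.Geometry.Lorentzian.VacuumCauchyDevelopment D, 𝒟.IsMaximal) ∧ ∀ 𝒟 : Literature.Geometry.Lorentzian.VacuumCauchyDevelopment D, 𝒟.IsMaximal → ∀ [𝒟.metric.HasLeviCivita], ∃ f : Metric.sphere (0 : Literature.Geometry.Lorentzian.E3) 1 → 𝒟.carrier, Set.range f ⊆ 𝒟.metric.causalFuture 𝒟.timeOrientation (Set.range 𝒟.embed) ∧ 𝒟.metric.IsTrappedSurface (𝓡 2) 𝒟.timeOrientation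 f; let Cens : Literature.Geometry.Lorentzian.InitialDataSet (𝓡 3) X → Prop := fun D ↦ ∀ 𝒟 : Literature.Geometry.Lorentzian.VacuumCauchyDevelopment D, 𝒟.IsMaximal → Summit.FinalStateConjecture.HasCompleteNullInfinity 𝒟.toCauchyDevelopment; let FinMany : Literature.Geometry.Lorentzian.InitialDataSet (𝓡 3) X → Prop := fun D ↦ ∀ 𝒟 : Literature.Geometry.Lorentzian.VacuumCauchyDevelopment D, 𝒟.IsMaximal → ∀ [𝒟.metric.HasLeviCivita], Finite (ConnectedComponents ↥(Literature.Geometry.Lorentzian.DataEmbedding.blackHoleRegion 𝒟.toDataEmbedding ∩ 𝒟.metric.causalFuture 𝒟.timeOrientation (Set.range 𝒟.embed))); ∀ d ∈ Literature.Geometry.Lorentzian.admissibleVacuumData X, ¬ P d → ((¬ Disp d ∧ Trap d ∧ Cens d ∧ ¬ Pw0 d) ∧ ¬ FinMany d) → ∃ (e : Literature.Geometry.Lorentzian.AFEnd X) (F : EuclideanSpace ℝ (Fin 1) → Literature.Geometry.Lorentzian.InitialDataSet (𝓡 3) X), Literature.Geometry.Lorentzian.InitialDataSet.IsTameDataFamily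 e 1 F ∧ Literature.Geometry.Lorentzian.InitialDataSet.IsImmersedAtZero 1 F ∧ F 0 = d ∧ Injective F ∧ (∀ c, F c ∈ Literature.Geometry.Lorentzian.admissibleVacuumData X) ∧ ∀ c ≠ 0, P (F c)

-- parent: TrappedCaptureExit · glue (gen 1)
/--     item stmt-FinalStateConjecture-26648 · support · rank 204 · open
    parent: TrappedCaptureExit · GLUE: children ⟹ parent · by planner
SingleHoleCaptureExit → MultiHoleCaptureExit → InfiniteHoleCaptureExit → TrappedCaptureExit -/
@[route_item "route-FinalStateConjecture-RootDecompTrappedBasinCells"]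
def TrappedCaptureExitGlue : Prop :=
  SingleHoleCaptureExit → MultiHoleCaptureExit → InfiniteHoleCaptureExit → TrappedCaptureExit

/-- item stmt-FinalStateConjecture-25598 · crux · rank 3 · open · by planner
why it might fail: a tame-open set of admissible vacuum data whose MGHD traps a sphere AND forms a naked singularity outside the resulting black hole (smooth-data analogue of the Hölder-class stability arXiv:2605.16235), or incompleteness of 𝓘⁺ generated by the black-hole region itself on an open set.
sources: doi:10.1088/0264-9381/22/11/019, arXiv:2402.10190, arXiv:2211.15742, arXiv:1912.08478, arXiv:2204.09891, arXiv:1407.4766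
[crux] PIECE 𝓣₁ — TrappedNakedExit [WEAKER·COUNTS·SPECIAL-TYPE — critic CLEARED
2026-08-30T02:40:09Z; weak cosmic censorship AFTER trapping (cell empty in the spherical
scalar-field model doi:10.1088/0264-9381/22/11/019, expected codim ≥ 1 in vacuum); subsumes lens-5's
TrappedNakedCell (critic ruling); leaf IDEA-NEEDED; BARRIER-adjacent nakedSingularityInstability
honoured as the cure]. For every Σ and every admissible P_Σ-exceptional datum d, not of dispersive
type, all of whose MGHDs contain a closed trapped sphere to the future of the data, and SOME of
whose MGHDs has incomplete future null infinity (weak cosmic censorship fails in the presence of a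
trapped sphere), there are one end e and a tame immersed injective one-parameter family F of
admissible data with F 0 = d whose members c ≠ 0 satisfy P_Σ. Model: the cell is EMPTY for
spherically symmetric Einstein–Maxwell–scalar field / Einstein–Vlasov (Dafermos 2005; Rendall 2008
§11.5); in vacuum 3+1 expected inhabited (naked-singularity datum superposed with a distant
collapsing region by localized gluing) with positive codimension. [difficulty: open-problem] -/
@[route_item "route-FinalStateConjecture-RootDecompTrappedBasinCells", crux]
def TrappedNakedExit : Prop :=
  ∀ (X : Type) [TopologicalSpace X] [ChartedSpace Literature.Geometry.Lorentzian.E3 X] [IsManifold (𝓡 3) ((⊤ : ℕ∞) : WithTop ℕ∞) X] [T2Space X] [SecondCountableTopology X] [ConnectedSpace X], let P : Literature.Geometry.Lorentzian.InitialDataSet (𝓡 3) X → Prop := fun D ↦ (∃ 𝒟 : Literature.Geometry.Lorentzian.VacuumCauchyDevelopment D, 𝒟.IsMaximal) ∧ ∀ 𝒟 : Literature.Geometry.Lorentzian.VacuumCauchyDevelopment D, 𝒟.IsMaximal → Summit.FinalStateConjecture.HasCompleteNullInfinity 𝒟.toCauchyDevelopment ∧ ∃ (O : Set 𝒟.carrier)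 (d : Literature.Geometry.Lorentzian.FinalStateDecomposition 𝒟.toSpacetime O 2), (∀ i, Literature.Geometry.Lorentzian.Kerr.IsSubextremal (d.mass i) (d.spin i)) ∧ O = Summit.FinalStateConjecture.exteriorOf 𝒟.toCauchyDevelopment d.charted ∧ Summit.FinalStateConjecture.RaysStayInClosure 𝒟.toCauchyDevelopment O ∧ Summit.FinalStateConjecture.HasExhaustiveCharts d ∧ Summit.FinalStateConjecture.IsFutureOriented d; let Disp : Literature.Geometry.Lorentzian.InitialDataSet (𝓡 3) X → Prop := fun D ↦ (∃ 𝒟 : Literature.Geometry.Lorentzian.VacuumCauchyDevelopment D, 𝒟.IsMaximal) ∧ ∀ 𝒟 : Literature.Geometry.Lorentzian.VacuumCauchyDevelopment D, 𝒟.IsMaximal → ∀ [𝒟.metric.HasLeviCivita], ¬ 𝒟.metric.IsFutureNullGeodesicallyIncomplete 𝒟.timeOrientation ∧ ¬ 𝒟.metric.IsFutureTimelikeGeodesicallyIncomplete 𝒟.timeOrientation; let Trap : Literature.Geometry.Lorentzian.InitialDataSet (𝓡 3) X → Prop := fun D ↦ (∃ 𝒟 : Literature.Geometry.Lorentzian.VacuumCauchyDevelopment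 D, 𝒟.IsMaximal) ∧ ∀ 𝒟 : Literature.Geometry.Lorentzian.VacuumCauchyDevelopment D, 𝒟.IsMaximal → ∀ [𝒟.metric.HasLeviCivita], ∃ f : Metric.sphere (0 : Literature.Geometry.Lorentzian.E3) 1 → 𝒟.carrier, Set.range f ⊆ 𝒟.metric.causalFuture 𝒟.timeOrientation (Set.range 𝒟.embed) ∧ 𝒟.metric.IsTrappedSurface (𝓡 2) 𝒟.timeOrientation f; let Cens : Literature.Geometry.Lorentzian.InitialDataSet (𝓡 3) X → Prop := fun D ↦ ∀ 𝒟 : Literature.Geometry.Lorentzian.VacuumCauchyDevelopment D, 𝒟.IsMaximal → Summit.FinalStateConjecture.HasCompleteNullInfinity 𝒟.toCauchyDevelopment; ∀ d ∈ Literature.Geometry.Lorentzian.admissibleVacuumData X, ¬ P d → (¬ Disp d ∧ Trap d ∧ ¬ Cens d) → ∃ (e : Literature.Geometry.Lorentzian.AFEnd X) (F : EuclideanSpace ℝ (Fin 1) → Literature.Geometry.Lorentzian.InitialDataSet (𝓡 3) X), Literature.Geometry.Lorentzian.InitialDataSet.IsTameDataFamily e 1 F ∧ Literature.Geometry.Lorentzian.InitialDataSet.IsImmersedAtZero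 1 F ∧ F 0 = d ∧ Injective F ∧ (∀ c, F c ∈ Literature.Geometry.Lorentzian.admissibleVacuumData X) ∧ ∀ c ≠ 0, P (F c)

/-- item stmt-FinalStateConjecture-25599 · crux · rank 4 · open · by planner
why it might fail: the set of trapped data with exactly extremal remnants could be tame-thick (accumulating on itself along every tame line through a member), or every tame exit from it could pass through uncensored data; vacuum extremal Kerr formation itself is open (arXiv:2402.10190 p.12).
sources: arXiv:2211.15742, arXiv:2402.10190, arXiv:2304.08455, Aretakis2015, arXiv:1402.7034, Israel1986
[crux] PIECE 𝓣₃ — TrappedExtremalExit [WEAKER·COUNTS·SPECIAL-TYPE — critic CLEARED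
2026-08-30T02:40:09Z; generic THIRD LAW after trapping (transversal crossing of |a_f|/M_f = 1 along
a tame line) + pointwise C⁰→C² upgrade at sub-extremal members (content pinned by
stmt-FinalStateConjecture-17298 SubextremalUpgrade, cited by name); MODEL-ANALOGUE in print not a
rung (arXiv:2211.15742 Thm 1); INSTRUMENTABLE (remnant-spin census); BARRIER AretakisInstability
OUTSIDE (asks to leave the cell)]. For every Σ and every admissible P_Σ-exceptional datum d, not of
dispersive type, all of whose MGHDs contain a closed trapped sphere to the future of the data, and
which SATISFIES the weak C⁰ property P_w⁰ (an MGHD exists; every MGHD has complete 𝓘⁺ and an honest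
C⁰ Kerr final-state decomposition with |a_i| ≤ M_i and the Statement's four clauses) — so that,
given the registered pointwise upgrade stmt-17298, d fails P_Σ exactly because one of its MGHDs has
only end states with an exactly extremal hole — there are one end e and a tame immersed injective
one-parameter family F of admissible data with F 0 = d whose members c ≠ 0 satisfy P_Σ. Content: the
generic third law after trapping (final |a_f|/ -/
@[route_item "route-FinalStateConjecture-RootDecompTrappedBasinCells", crux]
def TrappedExtremalExit : Prop :=
  ∀ (X : Type) [TopologicalSpace X] [ChartedSpace Literature.Geometry.Lorentzian.E3 X] [IsManifold (𝓡 3) ((⊤ : ℕ∞) : WithTop ℕ∞) X] [T2Space X] [SecondCountableTopology X] [ConnectedSpace X], let P : Literature.Geometry.Lorentzian.InitialDataSet (𝓡 3) X → Prop := fun D ↦ (∃ 𝒟 : Literature.Geometry.Lorentzian.VacuumCauchyDevelopment D, 𝒟.IsMaximal) ∧ ∀ 𝒟 : Literature.Geometry.Lorentzian.VacuumCauchyDevelopment D, 𝒟.IsMaximal → Summit.FinalStateConjecture.HasCompleteNullInfinity 𝒟.toCauchyDevelopment ∧ ∃ (O : Set 𝒟.carrier) (d : Literature.Geometry.Lorentzian.FinalStateDecomposition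 𝒟.toSpacetime O 2), (∀ i, Literature.Geometry.Lorentzian.Kerr.IsSubextremal (d.mass i) (d.spin i)) ∧ O = Summit.FinalStateConjecture.exteriorOf 𝒟.toCauchyDevelopment d.charted ∧ Summit.FinalStateConjecture.RaysStayInClosure 𝒟.toCauchyDevelopment O ∧ Summit.FinalStateConjecture.HasExhaustiveCharts d ∧ Summit.FinalStateConjecture.IsFutureOriented d; let Pw0 : Literature.Geometry.Lorentzian.InitialDataSet (𝓡 3) X → Prop := fun D ↦ (∃ 𝒟 : Literature.Geometry.Lorentzian.VacuumCauchyDevelopment D, 𝒟.IsMaximal) ∧ ∀ 𝒟 : Literature.Geometry.Lorentzian.VacuumCauchyDevelopment D, 𝒟.IsMaximal → Summit.FinalStateConjecture.HasCompleteNullInfinity 𝒟.toCauchyDevelopment ∧ ∃ (O : Set 𝒟.carrier) (d : Literature.Geometry.Lorentzian.FinalStateDecomposition 𝒟.toSpacetime O 0), O = Summit.FinalStateConjecture.exteriorOf 𝒟.toCauchyDevelopment d.charted ∧ Summit.FinalStateConjecture.RaysStayInClosure 𝒟.toCauchyDevelopment O ∧ Summit.FinalStateConjecture.HasExhaustiveCharts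 d ∧ Summit.FinalStateConjecture.IsFutureOriented d; let Disp : Literature.Geometry.Lorentzian.InitialDataSet (𝓡 3) X → Prop := fun D ↦ (∃ 𝒟 : Literature.Geometry.Lorentzian.VacuumCauchyDevelopment D, 𝒟.IsMaximal) ∧ ∀ 𝒟 : Literature.Geometry.Lorentzian.VacuumCauchyDevelopment D, 𝒟.IsMaximal → ∀ [𝒟.metric.HasLeviCivita], ¬ 𝒟.metric.IsFutureNullGeodesicallyIncomplete 𝒟.timeOrientation ∧ ¬ 𝒟.metric.IsFutureTimelikeGeodesicallyIncomplete 𝒟.timeOrientation; let Trap : Literature.Geometry.Lorentzian.InitialDataSet (𝓡 3) X → Prop := fun D ↦ (∃ 𝒟 : Literature.Geometry.Lorentzian.VacuumCauchyDevelopment D, 𝒟.IsMaximal) ∧ ∀ 𝒟 : Literature.Geometry.Lorentzian.VacuumCauchyDevelopment D, 𝒟.IsMaximal → ∀ [𝒟.metric.HasLeviCivita], ∃ f : Metric.sphere (0 : Literature.Geometry.Lorentzian.E3) 1 → 𝒟.carrier, Set.range f ⊆ 𝒟.metric.causalFuture 𝒟.timeOrientation (Set.range 𝒟.embed) ∧ 𝒟.metric.IsTrappedSurface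 (𝓡 2) 𝒟.timeOrientation f; ∀ d ∈ Literature.Geometry.Lorentzian.admissibleVacuumData X, ¬ P d → (¬ Disp d ∧ Trap d ∧ Pw0 d) → ∃ (e : Literature.Geometry.Lorentzian.AFEnd X) (F : EuclideanSpace ℝ (Fin 1) → Literature.Geometry.Lorentzian.InitialDataSet (𝓡 3) X), Literature.Geometry.Lorentzian.InitialDataSet.IsTameDataFamily e 1 F ∧ Literature.Geometry.Lorentzian.InitialDataSet.IsImmersedAtZero 1 F ∧ F 0 = d ∧ Injective F ∧ (∀ c, F c ∈ Literature.Geometry.Lorentzian.admissibleVacuumData X) ∧ ∀ c ≠ 0, P (F c)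

/-- item stmt-FinalStateConjecture-24765 · crux · rank 5 · open · by planner
why it might fail: the extremal critical set B_crit could be thick in the tame topology (extremal thresholds accumulating on themselves along every tame line), or leaving the threshold could land in naked data; vacuum extremal formation itself is open (arXiv:2402.10190 p.12).
sources: arXiv:2402.10190, arXiv:2211.15742, arXiv:2304.08455
[crux] PIECE 𝓝∧P_w — ExtremalThresholdExit [WEAKER·thin — critic CLEARED 2026-08-30T01:39:13Z with
retag: the printed Kehle–Unger exit family (arXiv:2402.10190 Thm 1, Einstein–Maxwell–Vlasov) is a
MODEL-ANALOGUE, not a rung; leaf IDEA-NEEDED; BARRIER placement: AretakisInstability concerns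
settling ON the threshold, this piece only asks to LEAVE it along a tame curve — outside; the bet is
transversality of B_crit]. For every Σ and every admissible P_Σ-exceptional datum d of threshold
type (not dispersive, not trapped) which satisfies the WEAK property P_w (an MGHD exists; every MGHD
has complete 𝓘⁺ and a Kerr final state decomposition with all the Statement's clauses but only |aᵢ|
≤ Mᵢ — so d fails P_Σ only through an exactly extremal final hole), there are one end e and a tame
immersed injective one-parameter family F of admissible data with F 0 = d whose members c ≠ 0
satisfy P_Σ. [difficulty: open-problem] -/
@[route_item "route-FinalStateConjecture-RootDecompTrappedBasinCells", crux]
def ExtremalThresholdExit : Prop :=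
  ∀ (X : Type) [TopologicalSpace X] [ChartedSpace Literature.Geometry.Lorentzian.E3 X] [IsManifold (𝓡 3) ((⊤ : ℕ∞) : WithTop ℕ∞) X] [T2Space X] [SecondCountableTopology X] [ConnectedSpace X], let P : Literature.Geometry.Lorentzian.InitialDataSet (𝓡 3) X → Prop := fun D ↦ (∃ 𝒟 : Literature.Geometry.Lorentzian.VacuumCauchyDevelopment D, 𝒟.IsMaximal) ∧ ∀ 𝒟 : Literature.Geometry.Lorentzian.VacuumCauchyDevelopment D, 𝒟.IsMaximal → Summit.FinalStateConjecture.HasCompleteNullInfinity 𝒟.toCauchyDevelopment ∧ ∃ (O : Set 𝒟.carrier) (d : Literature.Geometry.Lorentzian.FinalStateDecomposition 𝒟.toSpacetime O 2), (∀ i, Literature.Geometry.Lorentzian.Kerr.IsSubextremal (d.mass i) (d.spin i)) ∧ O = Summit.FinalStateConjecture.exteriorOf 𝒟.toCauchyDevelopment d.charted ∧ Summit.FinalStateConjecture.RaysStayInClosure 𝒟.toCauchyDevelopment O ∧ Summit.FinalStateConjecture.HasExhaustiveCharts d ∧ Summit.FinalStateConjecture.IsFutureOriented d; let Pw : Literature.Geometry.Lorentzian.InitialDataSet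 (𝓡 3) X → Prop := fun D ↦ (∃ 𝒟 : Literature.Geometry.Lorentzian.VacuumCauchyDevelopment D, 𝒟.IsMaximal) ∧ ∀ 𝒟 : Literature.Geometry.Lorentzian.VacuumCauchyDevelopment D, 𝒟.IsMaximal → Summit.FinalStateConjecture.HasCompleteNullInfinity 𝒟.toCauchyDevelopment ∧ ∃ (O : Set 𝒟.carrier) (d : Literature.Geometry.Lorentzian.FinalStateDecomposition 𝒟.toSpacetime O 2), O = Summit.FinalStateConjecture.exteriorOf 𝒟.toCauchyDevelopment d.charted ∧ Summit.FinalStateConjecture.RaysStayInClosure 𝒟.toCauchyDevelopment O ∧ Summit.FinalStateConjecture.HasExhaustiveCharts d ∧ Summit.FinalStateConjecture.IsFutureOriented d; let Disp : Literature.Geometry.Lorentzian.InitialDataSet (𝓡 3) X → Prop := fun D ↦ (∃ 𝒟 : Literature.Geometry.Lorentzian.VacuumCauchyDevelopment D, 𝒟.IsMaximal) ∧ ∀ 𝒟 : Literature.Geometry.Lorentzian.VacuumCauchyDevelopment D, 𝒟.IsMaximal → ∀ [𝒟.metric.HasLeviCivita], ¬ 𝒟.metric.IsFutureNullGeodesicallyIncomplete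 𝒟.timeOrientation ∧ ¬ 𝒟.metric.IsFutureTimelikeGeodesicallyIncomplete 𝒟.timeOrientation; let Trap : Literature.Geometry.Lorentzian.InitialDataSet (𝓡 3) X → Prop := fun D ↦ (∃ 𝒟 : Literature.Geometry.Lorentzian.VacuumCauchyDevelopment D, 𝒟.IsMaximal) ∧ ∀ 𝒟 : Literature.Geometry.Lorentzian.VacuumCauchyDevelopment D, 𝒟.IsMaximal → ∀ [𝒟.metric.HasLeviCivita], ∃ f : Metric.sphere (0 : Literature.Geometry.Lorentzian.E3) 1 → 𝒟.carrier, Set.range f ⊆ 𝒟.metric.causalFuture 𝒟.timeOrientation (Set.range 𝒟.embed) ∧ 𝒟.metric.IsTrappedSurface (𝓡 2) 𝒟.timeOrientation f; ∀ d ∈ Literature.Geometry.Lorentzian.admissibleVacuumData X, ¬ P d → (¬ Disp d ∧ ¬ Trap d ∧ Pw d) → ∃ (e : Literature.Geometry.Lorentzian.AFEnd X) (F : EuclideanSpace ℝ (Fin 1) → Literature.Geometry.Lorentzian.InitialDataSet (𝓡 3) X), Literature.Geometry.Lorentzian.InitialDataSet.IsTameDataFamily e 1 F ∧ Literature.Geometry.Lorentzian.InitialDataSet.IsImmersedAtZero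 1 F ∧ F 0 = d ∧ Injective F ∧ (∀ c, F c ∈ Literature.Geometry.Lorentzian.admissibleVacuumData X) ∧ ∀ c ≠ 0, P (F c)

/-- item stmt-FinalStateConjecture-24766 · crux · rank 6 · open · by planner
why it might fail: a non-radiating vacuum breather or a complete development with curvature not decaying at i⁺ whose tame neighbours are also exceptional (an open set) refutes it; no-breather results hold only near 𝓘 (arXiv:1504.04592) or for decaying solutions (arXiv:2108.13379).
sources: arXiv:2108.13379, arXiv:1504.04592, doi:10.1007/PL00001021
[crux] PIECE 𝓒 — DispersiveExit [WEAKER·thin — critic CLEARED 2026-08-30T01:39:13Z; implied outright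
by the registered pointwise item stmt-FinalStateConjecture-17320
`NoParkingWithoutHorizon.CompleteSpacetimesDisperse` (lens kernel
`dispersiveExit_of_completeSpacetimesDisperse`; cited by name, not re-typed); leaf IDEA-NEEDED;
attackable-now sub-rung: stationary-complete ⇒ flat (Lichnerowicz–Anderson port); rung stmt-10029
NoVacuumBreathers]. For every Σ and every admissible P_Σ-exceptional datum d of dispersive type (an
MGHD exists and every MGHD is future causally geodesically complete: no future null or timelike
geodesic incompleteness, stated under the metric's Levi-Civita instance), there are one end e and a
tame immersed injective one-parameter family F of admissible data with F 0 = d whose members c ≠ 0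
satisfy P_Σ. [difficulty: open-problem] -/
@[route_item "route-FinalStateConjecture-RootDecompTrappedBasinCells", crux]
def DispersiveExit : Prop :=
  ∀ (X : Type) [TopologicalSpace X] [ChartedSpace Literature.Geometry.Lorentzian.E3 X] [IsManifold (𝓡 3) ((⊤ : ℕ∞) : WithTop ℕ∞) X] [T2Space X] [SecondCountableTopology X] [ConnectedSpace X], let P : Literature.Geometry.Lorentzian.InitialDataSet (𝓡 3) X → Prop := fun D ↦ (∃ 𝒟 : Literature.Geometry.Lorentzian.VacuumCauchyDevelopment D, 𝒟.IsMaximal) ∧ ∀ 𝒟 : Literature.Geometry.Lorentzian.VacuumCauchyDevelopment D, 𝒟.IsMaximal → Summit.FinalStateConjecture.HasCompleteNullInfinity 𝒟.toCauchyDevelopment ∧ ∃ (O : Set 𝒟.carrier) (d : Literature.Geometry.Lorentzian.FinalStateDecomposition 𝒟.toSpacetime O 2), (∀ i, Literature.Geometry.Lorentzian.Kerr.IsSubextremal (d.mass i) (d.spin i)) ∧ O = Summit.FinalStateConjecture.exteriorOf 𝒟.toCauchyDevelopment d.charted ∧ Summit.FinalStateConjecture.RaysStayInClosure 𝒟.toCauchyDevelopment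 O ∧ Summit.FinalStateConjecture.HasExhaustiveCharts d ∧ Summit.FinalStateConjecture.IsFutureOriented d; let Disp : Literature.Geometry.Lorentzian.InitialDataSet (𝓡 3) X → Prop := fun D ↦ (∃ 𝒟 : Literature.Geometry.Lorentzian.VacuumCauchyDevelopment D, 𝒟.IsMaximal) ∧ ∀ 𝒟 : Literature.Geometry.Lorentzian.VacuumCauchyDevelopment D, 𝒟.IsMaximal → ∀ [𝒟.metric.HasLeviCivita], ¬ 𝒟.metric.IsFutureNullGeodesicallyIncomplete 𝒟.timeOrientation ∧ ¬ 𝒟.metric.IsFutureTimelikeGeodesicallyIncomplete 𝒟.timeOrientation; ∀ d ∈ Literature.Geometry.Lorentzian.admissibleVacuumData X, ¬ P d → Disp d → ∃ (e : Literature.Geometry.Lorentzian.AFEnd X) (F : EuclideanSpace ℝ (Fin 1) → Literature.Geometry.Lorentzian.InitialDataSet (𝓡 3) X), Literature.Geometry.Lorentzian.InitialDataSet.IsTameDataFamily e 1 F ∧ Literature.Geometry.Lorentzian.InitialDataSet.IsImmersedAtZero 1 F ∧ F 0 = d ∧ Injective F ∧ (∀ c, F c ∈ Literature.Geometry.Lorentzian.admissibleVacuumData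 X) ∧ ∀ c ≠ 0, P (F c)

/-- item stmt-FinalStateConjecture-24767 · crux · rank 7 · open · by planner
why it might fail: a smooth-data analogue of the Singh–Zheng stability — a tame-open set of admissible vacuum data forming naked singularities (RSR arXiv:1912.08478 exteriors are fine-tuned, consistent so far).
sources: Christodoulou1999, arXiv:1912.08478, arXiv:2204.09891, arXiv:2605.16235, arXiv:0811.0354
[crux] PIECE 𝓝∧¬P_w — NakedThresholdExit [WEAKER·COUNTS — critic CLEARED 2026-08-30T01:39:13Z; =
weak cosmic censorship on the untrapped incomplete sector in Christodoulou's own codimension form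
(the all-cells version is the registered hard core stmt-FinalStateConjecture-17269, cited; this is
its cell restriction with cure target P_Σ); leaf IDEA-NEEDED; BARRIER: nakedSingularityInstability
is the MODEL exit family (Christodoulou1999 Thm 4.1, 2-plane of exits) = the generic form, outside
the genericity-blind class; functional-framework dependence (Singh–Zheng arXiv:2605.16235:
Hölder-stable naked singularities in the spherical scalar field) — the bet is that smooth tame data
are on the unstable side]. For every Σ and every admissible P_Σ-exceptional datum d of threshold
type (not dispersive, not trapped) failing even the weak property P_w (no MGHD, or an MGHD with
incomplete 𝓘⁺, or censored but settling to no Kerr configuration with |aᵢ| ≤ Mᵢ), there are one end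
e and a tame immersed injective one-parameter family F of admissible data with F 0 = d whose members
c ≠ 0 satisfy P_Σ. [difficulty: open-problem] -/
@[route_item "route-FinalStateConjecture-RootDecompTrappedBasinCells", crux]
def NakedThresholdExit : Prop :=
  ∀ (X : Type) [TopologicalSpace X] [ChartedSpace Literature.Geometry.Lorentzian.E3 X] [IsManifold (𝓡 3) ((⊤ : ℕ∞) : WithTop ℕ∞) X] [T2Space X] [SecondCountableTopology X] [ConnectedSpace X], let P : Literature.Geometry.Lorentzian.InitialDataSet (𝓡 3) X → Prop := fun D ↦ (∃ 𝒟 : Literature.Geometry.Lorentzian.VacuumCauchyDevelopment D, 𝒟.IsMaximal) ∧ ∀ 𝒟 : Literature.Geometry.Lorentzian.VacuumCauchyDevelopment D, 𝒟.IsMaximal → Summit.FinalStateConjecture.HasCompleteNullInfinity 𝒟.toCauchyDevelopment ∧ ∃ (O : Set 𝒟.carrier) (d : Literature.Geometry.Lorentzian.FinalStateDecomposition 𝒟.toSpacetime O 2), (∀ i, Literature.Geometry.Lorentzian.Kerr.IsSubextremal (d.mass i) (d.spin i)) ∧ O = Summit.FinalStateConjecture.exteriorOf 𝒟.toCauchyDevelopment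 d.charted ∧ Summit.FinalStateConjecture.RaysStayInClosure 𝒟.toCauchyDevelopment O ∧ Summit.FinalStateConjecture.HasExhaustiveCharts d ∧ Summit.FinalStateConjecture.IsFutureOriented d; let Pw : Literature.Geometry.Lorentzian.InitialDataSet (𝓡 3) X → Prop := fun D ↦ (∃ 𝒟 : Literature.Geometry.Lorentzian.VacuumCauchyDevelopment D, 𝒟.IsMaximal) ∧ ∀ 𝒟 : Literature.Geometry.Lorentzian.VacuumCauchyDevelopment D, 𝒟.IsMaximal → Summit.FinalStateConjecture.HasCompleteNullInfinity 𝒟.toCauchyDevelopment ∧ ∃ (O : Set 𝒟.carrier) (d : Literature.Geometry.Lorentzian.FinalStateDecomposition 𝒟.toSpacetime O 2), O = Summit.FinalStateConjecture.exteriorOf 𝒟.toCauchyDevelopment d.charted ∧ Summit.FinalStateConjecture.RaysStayInClosure 𝒟.toCauchyDevelopment O ∧ Summit.FinalStateConjecture.HasExhaustiveCharts d ∧ Summit.FinalStateConjecture.IsFutureOriented d; let Disp : Literature.Geometry.Lorentzian.InitialDataSet (𝓡 3) X → Prop := fun D ↦ (∃ 𝒟 : Literature.Geometry.Lorentzian.VacuumCauchyDevelopment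 D, 𝒟.IsMaximal) ∧ ∀ 𝒟 : Literature.Geometry.Lorentzian.VacuumCauchyDevelopment D, 𝒟.IsMaximal → ∀ [𝒟.metric.HasLeviCivita], ¬ 𝒟.metric.IsFutureNullGeodesicallyIncomplete 𝒟.timeOrientation ∧ ¬ 𝒟.metric.IsFutureTimelikeGeodesicallyIncomplete 𝒟.timeOrientation; let Trap : Literature.Geometry.Lorentzian.InitialDataSet (𝓡 3) X → Prop := fun D ↦ (∃ 𝒟 : Literature.Geometry.Lorentzian.VacuumCauchyDevelopment D, 𝒟.IsMaximal) ∧ ∀ 𝒟 : Literature.Geometry.Lorentzian.VacuumCauchyDevelopment D, 𝒟.IsMaximal → ∀ [𝒟.metric.HasLeviCivita], ∃ f : Metric.sphere (0 : Literature.Geometry.Lorentzian.E3) 1 → 𝒟.carrier, Set.range f ⊆ 𝒟.metric.causalFuture 𝒟.timeOrientation (Set.range 𝒟.embed) ∧ 𝒟.metric.IsTrappedSurface (𝓡 2) 𝒟.timeOrientation f; ∀ d ∈ Literature.Geometry.Lorentzian.admissibleVacuumData X, ¬ P d → (¬ Disp d ∧ ¬ Trap d ∧ ¬ Pw d) → ∃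 (e : Literature.Geometry.Lorentzian.AFEnd X) (F : EuclideanSpace ℝ (Fin 1) → Literature.Geometry.Lorentzian.InitialDataSet (𝓡 3) X), Literature.Geometry.Lorentzian.InitialDataSet.IsTameDataFamily e 1 F ∧ Literature.Geometry.Lorentzian.InitialDataSet.IsImmersedAtZero 1 F ∧ F 0 = d ∧ Injective F ∧ (∀ c, F c ∈ Literature.Geometry.Lorentzian.admissibleVacuumData X) ∧ ∀ c ≠ 0, P (F c)

/-- item stmt-FinalStateConjecture-25600 · assembly · rank 1 · open · by planner
sources: doi:10.1103/PhysRevLett.14.57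
[assembly] DispersiveExit → TrappedNakedExit → TrappedCaptureExit → TrappedExtremalExit →
ExtremalThresholdExit → NakedThresholdExit → the final state conjecture as typed. -/
@[route_item "route-FinalStateConjecture-RootDecompTrappedBasinCells"]
def Assembly : Prop :=
  DispersiveExit → TrappedNakedExit → TrappedCaptureExit → TrappedExtremalExit → ExtremalThresholdExit → NakedThresholdExit → FinalStateConjecture

/-! D-0027 §2.1 — DECIDING THEOREM (planner-authored via `route open/edit --closes-file`; by planner-decomp-fsc-writer-1-g0-0 2026-08-30T02:43:41Z):
its hypotheses are this route's items and its conclusion the sub-problem Statement (glue_lint), and it elaborates with this file. -/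

@[closes "route-FinalStateConjecture-RootDecompTrappedBasinCells"] theorem closes (h₁ : DispersiveExit) (t₁ : TrappedNakedExit) (t₂ : TrappedCaptureExit) (t₃ : TrappedExtremalExit) (h₃ : ExtremalThresholdExit) (h₄ : NakedThresholdExit) : FinalStateConjecture := by
  intro X _ _ _ _ _ _ d hd
  suffices h : ∃ (e : Literature.Geometry.Lorentzian.AFEnd X) (F : EuclideanSpace ℝ (Fin 1) → Literature.Geometry.Lorentzian.InitialDataSet (𝓡 3) X), Literature.Geometry.Lorentzian.InitialDataSet.IsTameDataFamily e 1 F ∧ Literature.Geometry.Lorentzian.InitialDataSet.IsImmersedAtZero 1 F ∧ F 0 = d ∧ Injective F ∧ (∀ c, F c ∈ Literature.Geometry.Lorentzian.admissibleVacuumData X) ∧ ∀ c ≠ 0, ((∃ 𝒟 : Literature.Geometry.Lorentzian.VacuumCauchyDevelopment (F c), 𝒟.IsMaximal) ∧ ∀ 𝒟 : Literature.Geometry.Lorentzian.VacuumCauchyDevelopment (F c), 𝒟.IsMaximal → Summit.FinalStateConjecture.HasCompleteNullInfinity 𝒟.toCauchyDevelopment ∧ ∃ (O : Set 𝒟.carrier)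 (d : Literature.Geometry.Lorentzian.FinalStateDecomposition 𝒟.toSpacetime O 2), (∀ i, Literature.Geometry.Lorentzian.Kerr.IsSubextremal (d.mass i) (d.spin i)) ∧ O = Summit.FinalStateConjecture.exteriorOf 𝒟.toCauchyDevelopment d.charted ∧ Summit.FinalStateConjecture.RaysStayInClosure 𝒟.toCauchyDevelopment O ∧ Summit.FinalStateConjecture.HasExhaustiveCharts d ∧ Summit.FinalStateConjecture.IsFutureOriented d) by
    obtain ⟨e, F, h1, h2, h3, h4, h5, h6⟩ := h
    exact ⟨e, F, h1, h2, h3, h4, h5, fun c hc hmem ↦ hmem.2 (h6 c hc)⟩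
  by_cases hD : (∃ 𝒟 : Literature.Geometry.Lorentzian.VacuumCauchyDevelopment d, 𝒟.IsMaximal) ∧ ∀ 𝒟 : Literature.Geometry.Lorentzian.VacuumCauchyDevelopment d, 𝒟.IsMaximal → ∀ [𝒟.metric.HasLeviCivita], ¬ 𝒟.metric.IsFutureNullGeodesicallyIncomplete 𝒟.timeOrientation ∧ ¬ 𝒟.metric.IsFutureTimelikeGeodesicallyIncomplete 𝒟.timeOrientation
  · exact h₁ X d hd.1 hd.2 hD
  by_cases hT : (∃ 𝒟 : Literature.Geometry.Lorentzian.VacuumCauchyDevelopment d, 𝒟.IsMaximal) ∧ ∀ 𝒟 : Literature.Geometry.Lorentzian.VacuumCauchyDevelopment d, 𝒟.IsMaximal → ∀ [𝒟.metric.HasLeviCivita], ∃ f : Metric.sphere (0 : Literature.Geometry.Lorentzian.E3) 1 → 𝒟.carrier, Set.range f ⊆ 𝒟.metric.causalFuture 𝒟.timeOrientation (Set.range 𝒟.embed) ∧ 𝒟.metric.IsTrappedSurface (𝓡 2) 𝒟.timeOrientation f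
  · by_cases hW0 : (fun D ↦ (∃ 𝒟 : Literature.Geometry.Lorentzian.VacuumCauchyDevelopment D, 𝒟.IsMaximal) ∧ ∀ 𝒟 : Literature.Geometry.Lorentzian.VacuumCauchyDevelopment D, 𝒟.IsMaximal → Summit.FinalStateConjecture.HasCompleteNullInfinity 𝒟.toCauchyDevelopment ∧ ∃ (O : Set 𝒟.carrier) (d : Literature.Geometry.Lorentzian.FinalStateDecomposition 𝒟.toSpacetime O 0), O = Summit.FinalStateConjecture.exteriorOf 𝒟.toCauchyDevelopment d.charted ∧ Summit.FinalStateConjecture.RaysStayInClosure 𝒟.toCauchyDevelopment O ∧ Summit.FinalStateConjecture.HasExhaustiveCharts d ∧ Summit.FinalStateConjecture.IsFutureOriented d) d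
    · exact t₃ X d hd.1 hd.2 ⟨hD, hT, hW0⟩
    by_cases hC : (fun D ↦ ∀ 𝒟 : Literature.Geometry.Lorentzian.VacuumCauchyDevelopment D, 𝒟.IsMaximal → Summit.FinalStateConjecture.HasCompleteNullInfinity 𝒟.toCauchyDevelopment) d
    · exact t₂ X d hd.1 hd.2 ⟨hD, hT, hC, hW0⟩
    · exact t₁ X d hd.1 hd.2 ⟨hD, hT, hC⟩
  by_cases hW : (∃ 𝒟 : Literature.Geometry.Lorentzian.VacuumCauchyDevelopment d, 𝒟.IsMaximal) ∧ ∀ 𝒟 : Literature.Geometry.Lorentzian.VacuumCauchyDevelopment d, 𝒟.IsMaximal → Summit.FinalStateConjecture.HasCompleteNullInfinity 𝒟.toCauchyDevelopment ∧ ∃ (O : Set 𝒟.carrier) (d : Literature.Geometry.Lorentzian.FinalStateDecomposition 𝒟.toSpacetime O 2), O = Summit.FinalStateConjecture.exteriorOf 𝒟.toCauchyDevelopment d.charted ∧ Summit.FinalStateConjecture.RaysStayInClosure 𝒟.toCauchyDevelopment O ∧ Summit.FinalStateConjecture.HasExhaustiveCharts d ∧ Summit.FinalStateConjecture.IsFutureOriented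 d
  · exact h₃ X d hd.1 hd.2 ⟨hD, hT, hW⟩
  · exact h₄ X d hd.1 hd.2 ⟨hD, hT, hW⟩

end Summit.FinalStateConjecture.FinalStateConjecture.Theses.RootDecompTrappedBasinCells
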